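import Summits.RiemannHypothesis.RiemannHypothesis.Theses.IntegerScrew
import Literature.NumberTheory.LFunctions.ZetaScrewThm17Proofs

/-!
# `IntegerScrew.DiscreteLandau` (stmt-RiemannHypothesis-15758) — discrete Landau detection

`DiscreteLandau : (∀ m ≥ 1, Ψ(log m) ≥ 0) → RiemannHypothesis`, `Ψ = zetaScrew` (Suzuki2023 (1.1)).

The crux is the composition of two lemmas (line `robust-landau` of the crux chain, crux-strategist b1;
this file is that line's kernel-checked proof moved to Theorems shape):

* `nodeSlack` — NODE SLACK (real-variable, unconditional): integer sampling of `Ψ` loses at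
  most a constant: `∃ K, ∀ t ≥ 0, Ψ(log ⌊e^t⌋) - K ≤ Ψ(t)` (here `K = 6`). On the floor cell
  `log m ≤ t < log(m+1)` the archimedean part `4(e^{t/2}+e^{-t/2}-2)` is increasing, the Hurwitz–Lerch
  part `-¼ e^{-t/2} Φ(e^{-2t},2,¼)` is increasing, the linear part has slope `-c₀/2` with
  `c₀ = γ + π/2 + 3 log 2 + log π ≤ 8`, and the prime sum is affine on the cell with slope
  `S(m) = Σ_{n ≤ m} Λ(n)/√n ≤ 2m`; with `t - log m ≤ 1/m` the drop is `≤ 2 + 4`.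
* `robustLandau` — ROBUST LANDAU DETECTION (RH-free): if `Ψ ≥ -K` on `[0, ∞)` then
  `ξ(1/2 + w₀) ≠ 0` for every `Re w₀ > 0`. This is the tree's
  `ZetaScrewLandau.riemannXi_ne_zero_of_zetaScrew_nonneg` (ZetaScrewThm17Proofs.lean) run on
  `g(x) = Ψ(log x) + K ≥ 0` instead of `Ψ(log x)`: its transform is `R(s) + K/s` on `Re s > 1`,
  still holomorphic on `{Re s > 1} ∪ W₀` (the slack's only pole is `s = 0 ∉ W₀`), so
  `Landau.integrableOn_of_differentiableOn_union_convex` pushes absolute convergence of `g` — hence of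
  `Ψ∘log` after subtracting the integrable `K x^{-(σ+1)}` — below every `ε > 0`; the identity-theorem
  and order-of-vanishing half is then verbatim.

`DiscreteLandau_proof` composes: for `t ≥ 0` the node `⌊e^t⌋ ≥ 1`, so the crux hypothesis +
`nodeSlack` give `Ψ ≥ -K` on `[0,∞)`; `robustLandau` excludes zeros of `ξ(1/2+·)` in `Re > 0`,
i.e. zeros of `ζ` with `1/2 < Re s < 1` (`riemannXi_eq_zero_iff_holds`), which is RH
(`quasiRiemannHypothesis_one_half_iff_holds`).

Provenance: proof authored on the crux chain (planner-cstrat b1, Cruxes/DiscreteLandau/Lines/robust_landau.lean,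
`lean check` rc 0, 0 sorries); landed by the route prover. Axioms: propext, Classical.choice, Quot.sound.
-/

noncomputable section

-- the layout-mandated namespace `Summit.RiemannHypothesis.RiemannHypothesis.…` repeats the summit name
set_option linter.dupNamespace false

open Complex Filter Topology Set MeasureTheory Finset

namespace Summit.RiemannHypothesis.RiemannHypothesis.Theorems.IntegerScrewDiscreteLandau

open Literature.NumberTheory.LFunctions
open Literature.NumberTheory.LFunctions.ZetaScrewLandau

/-! ## Lemma 1: node slack -/

/-- **Node slack** (stub `stub_nodeSlack` of line robust-landau). Integer sampling of `Ψ` loses at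
most a constant: `Ψ(log ⌊e^t⌋) - 6 ≤ Ψ(t)` for `t ≥ 0`. (Suzuki2023 (1.1).) -/
theorem nodeSlack : ∃ K : ℝ, ∀ t : ℝ, 0 ≤ t →
    Literature.NumberTheory.LFunctions.zetaScrew (Real.log (⌊Real.exp t⌋₊ : ℕ)) - K ≤
      Literature.NumberTheory.LFunctions.zetaScrew t := by
  refine ⟨6, fun t ht ↦ ?_⟩
  generalize hm : ⌊Real.exp t⌋₊ = m
  -- the node `m = ⌊e^t⌋ ≥ 1` and `u = log m ∈ [0, t]`, `t - u ≤ 1/m`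
  have hm1 : 1 ≤ m := hm ▸ (Nat.one_le_floor_iff _).2 (Real.one_le_exp ht)
  have hmpos : (0 : ℝ) < m := by exact_mod_cast hm1
  have hm0 : (m : ℝ) ≠ 0 := hmpos.ne'
  have hm_le : (m : ℝ) ≤ Real.exp t := by rw [← hm]; exact Nat.floor_le (Real.exp_pos t).le
  have ht_lt : Real.exp t < (m : ℝ) + 1 := by rw [← hm]; exact Nat.lt_floor_add_one _
  set u : ℝ := Real.log (m : ℝ) with hu
  have hu0 : 0 ≤ u := Real.log_nonneg (by exact_mod_cast hm1)
  have hut : u ≤ t := by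
    calc u = Real.log m := hu
      _ ≤ Real.log (Real.exp t) := Real.log_le_log hmpos hm_le
      _ = t := Real.log_exp t
  have ht_lt_log : t < Real.log ((m : ℝ) + 1) := (Real.lt_log_iff_exp_lt (by positivity)).2 ht_lt
  have hlog1 : Real.log ((m : ℝ) + 1) - u ≤ 1 / m := by
    rw [hu, ← Real.log_div (by positivity) hm0]
    have h := Real.log_le_sub_one_of_pos (show (0 : ℝ) < ((m : ℝ) + 1) / m by positivity)
    have h' : ((m : ℝ) + 1) / m - 1 = 1 / m := by
      rw [div_sub_one hm0]
      congr 1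
      ring
    linarith
  have htu : t - u ≤ 1 / m := by linarith
  have htu1 : t - u ≤ 1 := htu.trans (by rw [div_le_one hmpos]; exact_mod_cast hm1)
  -- floors at `t` and at the node
  have hfloor_t : ⌊Real.exp |t|⌋₊ = m := by rw [abs_of_nonneg ht, hm]
  have hfloor_u : ⌊Real.exp |u|⌋₊ = m := by
    rw [abs_of_nonneg hu0, hu, Real.exp_log hmpos, Nat.floor_natCast]
  -- (1) the prime sum is affine on the cell with slope `S = Σ_{n ≤ m} Λ(n)/√n ∈ [0, 2m]`
  set S : ℝ := ∑ n ∈ Finset.Icc 1 m, ArithmeticFunction.vonMangoldt n / Real.sqrt n with hS_def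
  have hφ : zetaScrewPrimeSum t = zetaScrewPrimeSum u + (t - u) * S := by
    unfold zetaScrewPrimeSum
    rw [hfloor_t, hfloor_u, abs_of_nonneg ht, abs_of_nonneg hu0, hS_def, Finset.mul_sum,
      ← Finset.sum_add_distrib]
    refine Finset.sum_congr rfl fun n _ ↦ ?_
    ring
  have hS0 : 0 ≤ S :=
    Finset.sum_nonneg fun n _ ↦ div_nonneg ArithmeticFunction.vonMangoldt_nonneg (Real.sqrt_nonneg _)
  have hS2 : S ≤ 2 * m := by
    have hterm : ∀ n ∈ Finset.Icc 1 m, ArithmeticFunction.vonMangoldt n / Real.sqrt n ≤ 2 := by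
      intro n hn
      have hn1 : 1 ≤ n := (Finset.mem_Icc.1 hn).1
      have hn0 : (0 : ℝ) < n := by exact_mod_cast hn1
      have hsq : 0 < Real.sqrt n := Real.sqrt_pos.2 hn0
      rw [div_le_iff₀ hsq]
      calc (ArithmeticFunction.vonMangoldt n : ℝ) ≤ Real.log n := ArithmeticFunction.vonMangoldt_le_log
        _ ≤ (n : ℝ) ^ (1 / 2 : ℝ) / (1 / 2) := Real.log_le_rpow_div hn0.le (by norm_num)
        _ = 2 * Real.sqrt n := by rw [Real.sqrt_eq_rpow]; ring
    calc S = ∑ n ∈ Finset.Icc 1 m, ArithmeticFunction.vonMangoldt n / Real.sqrt n := hS_def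
      _ ≤ ∑ n ∈ Finset.Icc 1 m, (2 : ℝ) := Finset.sum_le_sum hterm
      _ = 2 * m := by simp [mul_comm]
  have hprod1 : (t - u) * S ≤ 2 := by
    calc (t - u) * S ≤ (1 / m) * (2 * m) := mul_le_mul htu hS2 hS0 (by positivity)
      _ = 2 := by field_simp
  -- (2) the linear term: `c₀ = γ + π/2 + 3 log 2 + log π ≤ 8`
  have hc0 : Real.eulerMascheroniConstant + Real.pi / 2 + 3 * Real.log 2 + Real.log Real.pi ≤ 8 := by
    have h1 := Real.eulerMascheroniConstant_lt_two_thirds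
    have h2 := Real.pi_lt_d2
    have h3 := Real.log_two_lt_d9
    have h4 := Real.log_le_sub_one_of_pos Real.pi_pos
    norm_num at h1 h2 h3
    linarith
  have hlin : (t - u) / 2 * (Real.eulerMascheroniConstant + Real.pi / 2 + 3 * Real.log 2 + Real.log Real.pi)
      ≤ (t - u) / 2 * 8 :=
    mul_le_mul_of_nonneg_left hc0 (by linarith)
  -- (3) the archimedean part `e^{x/2} + e^{-x/2} = 2 cosh(x/2)` is increasing on `[0, ∞)`
  have hA : Real.exp (u / 2) + Real.exp (-(u / 2)) ≤ Real.exp (t / 2) + Real.exp (-(t / 2)) := by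
    have h := Real.cosh_le_cosh.2 (show |u / 2| ≤ |t / 2| by
      rw [abs_of_nonneg (by linarith), abs_of_nonneg (by linarith)]; linarith)
    rw [Real.cosh_eq, Real.cosh_eq] at h
    linarith
  -- (4) the Hurwitz–Lerch part `e^{-x/2} Φ(e^{-2x}, 2, 1/4)` is non-increasing on `[0, ∞)`
  have hHle : hurwitzLerchQuarter t ≤ hurwitzLerchQuarter u := by
    unfold hurwitzLerchQuarter
    refine (summable_hurwitzLerchQuarter t).tsum_le_tsum (fun k ↦ ?_) (summable_hurwitzLerchQuarter u)
    apply div_le_div_of_nonneg_right ?_ (by positivity)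
    apply Real.exp_le_exp.2
    rw [abs_of_nonneg ht, abs_of_nonneg hu0]
    have hk : (0 : ℝ) ≤ k := Nat.cast_nonneg k
    nlinarith
  have hH : Real.exp (-(t / 2)) * hurwitzLerchQuarter t ≤ Real.exp (-(u / 2)) * hurwitzLerchQuarter u :=
    mul_le_mul (Real.exp_le_exp.2 (by linarith)) hHle (hurwitzLerchQuarter_nonneg t) (Real.exp_pos _).le
  -- assemble: `Ψ(u) - Ψ(t) ≤ (t - u) S + (t - u) c₀/2 ≤ 2 + 4`
  have key : zetaScrew u - zetaScrew t ≤ (t - u) * S + (t - u) / 2 * 8 := by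
    rw [zetaScrew_eq u, zetaScrew_eq t, abs_of_nonneg hu0, abs_of_nonneg ht]
    linarith [hA, hH, hφ, hlin]
  linarith [key, hprod1, htu1]

/-! ## Lemma 2: robust Landau detection -/

/-- The slack term `K x^{-(σ+1)}` is integrable on `(1, ∞)` for `σ > 0`.  -/
theorem integrableOn_const_mul_rpow (K : ℝ) {σ : ℝ} (hσ : 0 < σ) :
    IntegrableOn (fun x : ℝ ↦ K * x ^ (-(σ + 1))) (Ioi 1) :=
  (integrableOn_Ioi_rpow_of_lt (by linarith) zero_lt_one).const_mul K

/-- Shifting `Ψ∘log` by a constant does not change absolute convergence of the Mellin integrand on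
`(1, ∞)` at any `σ > 0`.  -/
theorem integrableOn_shift_iff (K : ℝ) {σ : ℝ} (hσ : 0 < σ) :
    IntegrableOn (fun x : ℝ ↦ (zetaScrew (Real.log x) + K) * x ^ (-(σ + 1))) (Ioi 1) ↔
      IntegrableOn (fun x : ℝ ↦ zetaScrew (Real.log x) * x ^ (-(σ + 1))) (Ioi 1) := by
  have hK := integrableOn_const_mul_rpow K hσ
  constructor
  · intro h
    refine (h.sub hK).congr_fun (fun x _ ↦ ?_) measurableSet_Ioi
    simp only [Pi.sub_apply]
    ring
  · intro h
    refine (h.add hK).congr_fun (fun x _ ↦ ?_) measurableSet_Ioi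
    simp only [Pi.add_apply]
    ring

/-- **Robust Landau detection** (stub `stub_robustLandau` of line robust-landau). If `Ψ(t) ≥ -K` for all
`t ≥ 0` then `ξ(1/2 + w₀) ≠ 0` for `Re w₀ > 0`. (Suzuki2023 §7.2, proof of Thm 1.7.) -/
theorem robustLandau : ∀ K : ℝ,
    (∀ t : ℝ, 0 ≤ t → -K ≤ Literature.NumberTheory.LFunctions.zetaScrew t) →
    ∀ w₀ : ℂ, 0 < w₀.re → Literature.NumberTheory.LFunctions.riemannXi (1 / 2 + w₀) ≠ 0 := by
  intro K hΨ w₀ hw₀ hzero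
  -- zeros of `ξ(1/2 + ·)` have real part `< 1/2`
  have hw₀' : w₀.re < 1 / 2 := by
    by_contra h
    exact riemannXi_ne_zero_of_one_le_re (by simp; linarith) hzero
  have hg₀ : Measurable (fun x : ℝ ↦ zetaScrew (Real.log x)) :=
    continuous_zetaScrew.measurable.comp Real.measurable_log
  have hg : Measurable (fun x : ℝ ↦ zetaScrew (Real.log x) + K) := hg₀.add_const K
  set R : ℂ → ℂ := fun s ↦ 1 / s ^ 2 * logDeriv riemannXi (1 / 2 + s) with hR_def
  set Φ : ℂ → ℂ := fun s ↦ R s + (K : ℂ) / s with hΦ_def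
  set ε : ℝ := w₀.re / 2 with hε_def
  have hε : 0 < ε := by positivity
  have hε1 : ε < 1 := by rw [hε_def]; linarith
  -- a zero-free thin rectangle around the real segment `[ε/2, 3]` (verbatim the tree)
  set Kc : Set ℂ := (fun σ : ℝ ↦ (σ : ℂ)) '' Icc (ε / 2) 3 with hKc_def
  have hKcc : IsCompact Kc := (isCompact_Icc.image Complex.continuous_ofReal)
  set U : Set ℂ := {s : ℂ | riemannXi (1 / 2 + s) ≠ 0} with hU_def
  have hUo : IsOpen U := by
    have : U = (fun s : ℂ ↦ riemannXi (1 / 2 + s)) ⁻¹' {0}ᶜ := rfl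
    rw [this]
    exact isOpen_compl_singleton.preimage (differentiable_riemannXi.continuous.comp (by fun_prop))
  have hKU : Kc ⊆ U := by
    rintro _ ⟨σ, _, rfl⟩
    exact riemannXi_half_add_ofReal_ne_zero σ
  obtain ⟨d₀, hd₀, hthick⟩ := hKcc.exists_thickening_subset_open hUo hKU
  set W₀ : Set ℂ := {s : ℂ | ε / 2 < s.re ∧ s.re < 3 ∧ -d₀ < s.im ∧ s.im < d₀} with hW₀_def
  have hW₀eq : W₀ = {s : ℂ | ε / 2 < s.re} ∩ ({s : ℂ | s.re < 3} ∩ ({s : ℂ | -d₀ < s.im} ∩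
      {s : ℂ | s.im < d₀})) := by
    ext s; simp [hW₀_def]
  have hW₀o : IsOpen W₀ := by
    rw [hW₀eq]
    exact (isOpen_lt continuous_const Complex.continuous_re).inter
      ((isOpen_lt Complex.continuous_re continuous_const).inter
        ((isOpen_lt continuous_const Complex.continuous_im).inter
          (isOpen_lt Complex.continuous_im continuous_const)))
  have hW₀c : Convex ℝ W₀ := by
    rw [hW₀eq]
    exact (convex_halfSpace_re_gt _).inter ((convex_halfSpace_re_lt _).inter
      ((convex_halfSpace_im_gt _).inter (convex_halfSpace_im_lt _)))
  have hW₀U : W₀ ⊆ U := by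
    intro s hs
    refine hthick (Metric.mem_thickening_iff.2 ⟨(s.re : ℂ), ⟨s.re, ⟨hs.1.le, hs.2.1.le⟩, rfl⟩, ?_⟩)
    rw [dist_eq_norm]
    have : s - (s.re : ℂ) = (s.im : ℂ) * I := by
      apply Complex.ext <;> simp
    rw [this, norm_mul, Complex.norm_I, mul_one, Complex.norm_real, Real.norm_eq_abs, abs_lt]
    exact ⟨hs.2.2.1, hs.2.2.2⟩
  have hW₀r : ∀ σ : ℝ, ε < σ → σ ≤ 1 + 1 → (σ : ℂ) ∈ W₀ := by
    intro σ h1 h2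
    simp only [hW₀_def, Set.mem_setOf_eq, ofReal_re, ofReal_im, neg_lt_zero]
    exact ⟨by linarith, by linarith, hd₀, hd₀⟩
  -- `Φ = R + K/s` is holomorphic on `{Re s > 1} ∪ W₀` (the slack's pole `0` is outside)
  have hΦd : DifferentiableOn ℂ Φ ({s : ℂ | 1 < s.re} ∪ W₀) := by
    intro s hs
    have hs0 : s ≠ 0 := by
      intro h0
      rcases hs with hs | hs
      · simp only [Set.mem_setOf_eq, h0, zero_re] at hs; linarith
      · have := hs.1; rw [h0, zero_re] at this; linarith
    have hξ : riemannXi (1 / 2 + s) ≠ 0 := by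
      rcases hs with hs | hs
      · exact riemannXi_ne_zero_of_one_le_re (by simp only [Set.mem_setOf_eq] at hs; simp; linarith)
      · exact hW₀U hs
    have h1 : DifferentiableAt ℂ R s := differentiableAt_R hs0 hξ
    have h2 : DifferentiableAt ℂ (fun s : ℂ ↦ (K : ℂ) / s) s :=
      (differentiableAt_const _).div differentiableAt_id hs0
    exact (h1.add h2).differentiableWithinAt
  -- and agrees with the transform of `g = Ψ∘log + K` on `Re s > 1`
  have hagree : EqOn Φ (Landau.mellinIoi (fun x : ℝ ↦ zetaScrew (Real.log x) + K))
      {s : ℂ | 1 < s.re} := by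
    intro s hs
    simp only [Set.mem_setOf_eq] at hs
    have ha : (-(s + 1)).re < -1 := by simp; linarith
    have hΨint : Integrable (fun x : ℝ ↦ ((zetaScrew (Real.log x) : ℝ) : ℂ) * (x : ℂ) ^ (-(s + 1)))
        (volume.restrict (Ioi 1)) := by
      have h := Landau.integrable_mellinIntegrand hg₀
        (integrableOn_zetaScrew_log_rpow (σ := 1) (by norm_num)) 0 (s := s) hs
      refine h.congr (Eventually.of_forall fun x ↦ ?_)
      simp [Landau.mellinIntegrand]
    have hKint : Integrable (fun x : ℝ ↦ ((K : ℝ) : ℂ) * (x : ℂ) ^ (-(s + 1)))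
        (volume.restrict (Ioi 1)) :=
      (integrableOn_Ioi_cpow_of_lt ha zero_lt_one).const_mul _
    have hcpow : ∫ x in Ioi (1 : ℝ), (x : ℂ) ^ (-(s + 1)) = 1 / s := by
      rw [integral_Ioi_cpow_of_lt ha zero_lt_one]
      have h : -(s + 1) + 1 = -s := by ring
      rw [h, Complex.ofReal_one, Complex.one_cpow, neg_div_neg_eq]
    have hR : R s = Landau.mellinIoi (fun x : ℝ ↦ zetaScrew (Real.log x)) s :=
      (mellinIoi_eq_of_re_gt (by linarith)).symm
    symm
    calc Landau.mellinIoi (fun x : ℝ ↦ zetaScrew (Real.log x) + K) s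
        = ∫ x in Ioi (1 : ℝ), (((zetaScrew (Real.log x) : ℝ) : ℂ) * (x : ℂ) ^ (-(s + 1))
            + ((K : ℝ) : ℂ) * (x : ℂ) ^ (-(s + 1))) := by
          unfold Landau.mellinIoi
          refine setIntegral_congr_fun measurableSet_Ioi fun x _ ↦ ?_
          push_cast
          ring
      _ = Landau.mellinIoi (fun x : ℝ ↦ zetaScrew (Real.log x)) s
            + (K : ℂ) * ∫ x in Ioi (1 : ℝ), (x : ℂ) ^ (-(s + 1)) := by
          rw [integral_add hΨint hKint, integral_const_mul]
          rfl
      _ = Φ s := by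
          rw [hcpow]
          simp only [hΦ_def, hR]
          ring
  -- Landau for the non-negative `g`: absolute convergence for every `σ > ε`
  have hint : IntegrableOn (fun x : ℝ ↦ (zetaScrew (Real.log x) + K) * x ^ (-((1 : ℝ) + 1)))
      (Ioi 1) :=
    (integrableOn_shift_iff K one_pos).2 (integrableOn_zetaScrew_log_rpow (by norm_num))
  have hpos : ∀ x : ℝ, 1 < x → 0 ≤ zetaScrew (Real.log x) + K := by
    intro x hx
    have := hΨ (Real.log x) (Real.log_pos hx).le
    linarith
  have hS' : ∀ σ' : ℝ, ε < σ' →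
      IntegrableOn (fun x : ℝ ↦ (zetaScrew (Real.log x) + K) * x ^ (-(σ' + 1))) (Ioi 1) :=
    fun σ' hσ' ↦ Landau.integrableOn_of_differentiableOn_union_convex hg hint le_rfl hpos
      hε1 hW₀o hW₀c hW₀r hΦd hagree hσ'
  -- hence for `Ψ∘log` itself (the slack term is integrable for `σ' > 0`)
  have hS : ∀ σ' : ℝ, ε < σ' →
      IntegrableOn (fun x : ℝ ↦ zetaScrew (Real.log x) * x ^ (-(σ' + 1))) (Ioi 1) :=
    fun σ' hσ' ↦ (integrableOn_shift_iff K (hε.trans hσ')).1 (hS' σ' hσ')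
  -- from here on verbatim the tree: holomorphy of `F` on `Re s > ε`, identity theorem, orders
  set F : ℂ → ℂ := Landau.mellinIoi (fun x : ℝ ↦ zetaScrew (Real.log x)) with hF_def
  have hFdiff : DifferentiableOn ℂ F {s : ℂ | ε < s.re} :=
    Landau.differentiableOn_mellinIoi_of_forall hg₀ hS
  have hFR : EqOn F R {s : ℂ | 1 < s.re} := by
    intro s hs
    simp only [Set.mem_setOf_eq] at hs
    exact mellinIoi_eq_of_re_gt (by linarith)
  set H : Set ℂ := {s : ℂ | ε < s.re} with hH_def
  have hHo : IsOpen H := isOpen_lt continuous_const Complex.continuous_re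
  have hHpre : IsPreconnected H := (convex_halfSpace_re_gt ε).isPreconnected
  set Z : ℂ → ℂ := fun s ↦ riemannXi (1 / 2 + s) with hZ_def
  have hZd : Differentiable ℂ Z := differentiable_riemannXi.comp (by fun_prop)
  have hZa : ∀ s, AnalyticAt ℂ Z s := fun s ↦ hZd.analyticAt s
  have hderivZ : ∀ s, deriv Z s = deriv riemannXi (1 / 2 + s) := fun s ↦ by
    simp only [hZ_def]
    exact deriv_comp_const_add riemannXi (1 / 2) s
  set G : ℂ → ℂ := fun s ↦ F s * s ^ 2 with hG_def
  have hGa : ∀ s ∈ H, AnalyticAt ℂ G s := fun s hs ↦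
    ((hFdiff.analyticOnNhd hHo) s hs).mul ((analyticAt_id.pow 2))
  have hf₁ : AnalyticOnNhd ℂ (G * Z) H := fun s hs ↦ (hGa s hs).mul (hZa s)
  have hf₂ : AnalyticOnNhd ℂ (deriv Z) H := fun s _ ↦ (hZa s).deriv
  have h2H : (2 : ℂ) ∈ H := by simp [hH_def]; linarith
  have hev2 : (G * Z) =ᶠ[𝓝 (2 : ℂ)] deriv Z := by
    have hopen : IsOpen {s : ℂ | 1 < s.re} := isOpen_lt continuous_const Complex.continuous_re
    filter_upwards [hopen.mem_nhds (show (2 : ℂ) ∈ {s : ℂ | 1 < s.re} by simp)] with s hs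
    have hs' : 1 < s.re := hs
    have hξ : riemannXi (1 / 2 + s) ≠ 0 := riemannXi_ne_zero_of_one_le_re (by simp; linarith)
    have hs0 : s ≠ 0 := fun h ↦ by rw [h, zero_re] at hs'; linarith
    rw [Pi.mul_apply, hderivZ s]
    simp only [hG_def, hZ_def]
    rw [hFR hs]
    simp only [hR_def]
    rw [logDeriv_apply]
    set A : ℂ := deriv riemannXi (1 / 2 + s)
    set B : ℂ := riemannXi (1 / 2 + s)
    field_simp
  have hEqOn : EqOn (G * Z) (deriv Z) H := hf₁.eqOn_of_preconnected_of_eventuallyEq hf₂ hHpre h2H hev2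
  -- orders at `w₀`
  have hw₀H : w₀ ∈ H := by simp [hH_def, hε_def]; linarith
  have hev : deriv Z =ᶠ[𝓝 w₀] G * Z := by
    filter_upwards [hHo.mem_nhds hw₀H] with s hs
    exact (hEqOn hs).symm
  have hZ0 : Z w₀ = 0 := hzero
  have h1 : analyticOrderAt (deriv Z) w₀ + 1 = analyticOrderAt Z w₀ := by
    have := (hZa w₀).analyticOrderAt_deriv_add_one
    simpa [hZ0] using this
  have h2 : analyticOrderAt (deriv Z) w₀ = analyticOrderAt G w₀ + analyticOrderAt Z w₀ := by
    rw [analyticOrderAt_congr hev, analyticOrderAt_mul (hGa w₀ hw₀H) (hZa w₀)]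
  rw [h2] at h1
  -- `Z` is not locally zero (else `ξ ≡ 0`), so its order is finite, contradiction
  generalize hoZ : analyticOrderAt Z w₀ = oZ at h1
  generalize hoG : analyticOrderAt G w₀ = oG at h1
  cases oZ with
  | top =>
    have hloc : ∀ᶠ s in 𝓝 w₀, Z s = 0 := analyticOrderAt_eq_top.1 hoZ
    have hall : EqOn Z 0 univ :=
      (hZd.differentiableOn.analyticOnNhd isOpen_univ).eqOn_zero_of_preconnected_of_eventuallyEq_zero
        isPreconnected_univ (Set.mem_univ w₀) hloc
    have h1' : Z 1 = 0 := hall (Set.mem_univ 1)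
    simp only [hZ_def] at h1'
    exact riemannXi_ne_zero_of_one_le_re (s := 1 / 2 + 1) (by norm_num) h1'
  | coe n =>
    cases oG with
    | top => simp at h1
    | coe m =>
      have h' : (m + n + 1 : ℕ) = n := by exact_mod_cast h1
      omega

/-! ## The crux -/

/-- **Crux `IntegerScrew.DiscreteLandau` (stmt-RiemannHypothesis-15758), RH-free discrete Landau
detection:** if `Ψ(log m) ≥ 0` for every positive integer `m`, then the Riemann Hypothesis holds.
Proof: the hypothesis at the nodes `⌊e^t⌋` plus `nodeSlack` gives `Ψ ≥ -K` on `[0, ∞)`;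
`robustLandau` then excludes zeros of `ξ(1/2 + ·)` in `Re > 0`, i.e. zeros of `ζ` in
`1/2 < Re s < 1`, which is RH (`quasiRiemannHypothesis_one_half_iff_holds`). -/
theorem DiscreteLandau_proof :
    Summit.RiemannHypothesis.RiemannHypothesis.Theses.IntegerScrew.DiscreteLandau := by
  unfold Summit.RiemannHypothesis.RiemannHypothesis.Theses.IntegerScrew.DiscreteLandau
  intro hm
  obtain ⟨K, hK⟩ := nodeSlack
  -- the crux hypothesis at the nodes + node slack: `Ψ ≥ -K` on `[0, ∞)`
  have hbdd : ∀ t : ℝ, 0 ≤ t → -K ≤ zetaScrew t := by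
    intro t ht
    have hfloor : 1 ≤ ⌊Real.exp t⌋₊ := (Nat.one_le_floor_iff _).2 (Real.one_le_exp ht)
    have hnode := hm _ hfloor
    have hint := hK t ht
    linarith
  -- no zeros of `ξ(1/2 + ·)` in `Re > 0` ⇒ no zeros of `ζ` in `1/2 < Re s < 1` ⇒ RH
  refine quasiRiemannHypothesis_one_half_iff_holds.1 fun s hs h1' h2' ↦ ?_
  have hξ : riemannXi s = 0 := (riemannXi_eq_zero_iff_holds s).2 ⟨hs, by linarith, h2'⟩
  have hw : 0 < (s - 1 / 2).re := by simp; linarith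
  refine robustLandau K hbdd (s - 1 / 2) hw ?_
  rw [show (1 / 2 : ℂ) + (s - 1 / 2) = s by ring]
  exact hξ

end Summit.RiemannHypothesis.RiemannHypothesis.Theorems.IntegerScrewDiscreteLandau

end
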